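import Literature.MathematicalPhysics.QuantumFieldTheory.Balaban1983to89.B9Eq3119DeltaPiCarrier
import Literature.MathematicalPhysics.QuantumFieldTheory.Balaban1983to89.B9Eq319QprimeLipschitz
import Literature.MathematicalPhysics.QuantumFieldTheory.Balaban1983to89.B9Eq387CubeLocalisedProjection

/-!
# `Balaban1983to89.B9Eq387CubeSupportLetters` — T. Bałaban, *Propagators for lattice gauge theories in a background field*, Commun. Math. Phys. **99**
# (1985) 389–434 [Balaban1985BackgroundPropagators] Cor. 3.6 p. 408 («operators … constructed for the sequence {Ω_j} … restricted to the cube □»), (3.87) p. 409,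
# (3.19) p. 393, (3.24) p. 394: **THE SUPPORT LETTERS OF THE CUBE-LOCALISED PROJECTION AT THE LATTICE — for a cube given as a BLOCK HULL `ȳ⁻¹(Y)`
# (`Y` a set of coarse sites): the constraint submodule `N_□ = {λ : λ(x) = 0 off ȳ⁻¹(Y)}` EXISTS as a `Submodule`; a cutoff `θ = σ·` with `σ = 0` off the
# hull maps INTO `N_□` (`hθN`); the background averaging `Q′(U)` is BLOCK-LOCAL (`λ = 0` on `B(y)` ⇒ `(Q′(U)λ)(y) = 0`); hence every BLOCK-LOCAL section `Ψ`
# (`g(y) = 0 ⇒ (Ψg)(x) = 0` on `B(y)` — the clause of `B9Eq319BumpSectionBackgroundExact`) satisfies `Ψ(Q′(U)(θλ)) ∈ N_□` (`hΨN`); the cube constraint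
# `ker Q′ ⊓ N_□ ≤ ker(Q′ × mk_{N_□})` (`hker`); and the Green data `(H, G) = (Δ′_{a′}(U), G′(U))` of the chain satisfy `Q′λ = 0 ⇒ Hλ = Δ^η_Uλ`, `G(Hλ) = λ`
# (`hH`, `hGH`)** — the five STRUCTURE letters of S-P6′(β) `B9Eq387CubeLocalisedProjection.norm_sub_projR_cube_le(_nearfield∕_weighted)` INHABITED at the
# lattice, at any background, with NO estimate

statement-level skeleton of published theorems with citation tags; proofs where landed; nothing here is a claim about the Yang–Mills mass gap

CITATION HEADER (lean-in-tree rule).  Audit cell `pub-balaban`, sub-cell `t4`, BINDER row NE9; filed by NE9 formalisation-swarm LEAF PROVER 05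
(`b2b-balaban-t4-ne9-formalise-leaf-05`, gen 76), route R2′ STEP B8′ S-P6′(β) (ROUTES-NE9 §L1.2).  S-P6′(β) (ne9-leaf-06 g64's port of t4-ne9-idea-1 g85's kernel)
displays, besides its SIZE letters (`τ, a₁, a₀, b₀, c_P, C_Ψ` — this lineage's `B9Eq388KhCommutator*`, `B9Eq319BumpSection*` and the chain's decay files), five
STRUCTURE letters: the cube constraint `hker : ker Q′ ⊓ N ≤ ker Q″`, the cutoff's range `hθN : θ s ∈ N`, the section's range `hΨN : Ψ(Q′(θ s)) ∈ N`, and the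
Green data `hH : Q′u = 0 → Hu = Δ_s u`, `hGH : G(Hs) = s`.  This file inhabits all five at the lattice for the natural cube of the route (a union of averaging
blocks), so that a junction writer is left with the size letters only.  Sources READ: [Balaban1985BackgroundPropagators] p. 408 Cor. 3.6 (cube operators with
restricted domains), p. 409 (3.87) (`G′₀ = Σ_□ h_□G′_□h_□`), p. 393 (3.19) (block averaging — each `(Q′(U)λ)(y)` reads `λ` on `B(y)` only), p. 394 (3.24)
(`Δ′_a(U) = Δ^η_U + Q′*(U)aQ′(U)`).  Print restricts DOMAINS; the route restricts the CONSTRAINT (`ker Q″ = ker Q′ ⊓ N_□`) — the cell's device, NOT print's.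

WHAT IS PROVED (sorry-free; proof lane — no `def`: the submodule is produced by an `∃` clause; [folklore] support bookkeeping + two identities BY NAME).
* §1 **`exists_blockHull_submodule`** — `∃ N : Submodule ℂ (L²(sites))`, `λ ∈ N ↔ ∀ x, ȳ(x) ∉ Y → λ(x) = 0`.
* §2 **`mul_mem_of_vanish`** (`hθN`) — a pointwise multiplier `θλ(x) = σ(x)·λ(x)` with `σ(x) = 0` whenever `ȳ(x) ∉ Y` maps into such an `N`.
* §3 **`QprimeW_apply_eq_zero_of_vanish_on_block`** — BLOCK-LOCALITY of `Q′(U)` in the bond window `‖R(U(b))w − w‖ ≤ ε‖w‖`: `λ = 0` on `B(y)` ⇒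
  `(Q′(U)λ)(y) = 0` (the (ρ′) block form `B9Eq319QprimeLipschitz.norm_QprimeW_sub_flat_apply_le` squeezes it onto the flat block mean).
* §4 **`section_QprimeW_mul_mem`** (`hΨN`) — for ANY block-local `Ψ : L²(T_m; c₁) → L²(T_{Lm}; c₀)` and `Q′ := (L²-reading)⁻¹ ∘ Q′(U)`: `Ψ(Q′(θλ)) ∈ N`.
* §5 **`ker_inf_le_ker_prod_mkQ`** (`hker`) — `ker Q′ ⊓ N ≤ ker(Q′ × N.mkQ)` from S-P6′ §2's `ker_prod_mkQ` BY NAME.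
* §6 **`laplacePrimeA_eq_of_ker`** (`hH`) and **`GpOfU_laplacePrimeA`** (`hGH`) — the chain's `Δ′_{a′}(U)` (`B9Eq3119DeltaPiCarrier.laplacePrimeA`) agrees with
  `Δ^η_U = covLaplaceSiteK` on `ker Q′`, and `G′(U) = GpOfU` is its left inverse (`greenK_apply`), in the consumer's binder shapes.
HONEST SCOPE.  Structure only: no inequality, no constant; the cube is a block hull (print's cubes `□ ∈ 𝒟_j` are unions of `j`-blocks — consistent, but the
multi-level `{Ω_j}` geometry is NOT modelled); ONE averaging step.  NOT NE9 (cell pub-balaban: NE9 NOT PRINTED ∕ NOT PROVED; «NE9 ⇐ the named binders»; row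
WALLED ON A MODEL (O-NE9-1; #5 UNRULED); spine PROVED 0∕9; rung (B)+1 on a finite T⁴ — NOT infinite volume, NOT mass gap, NOT BetaPertH, NOT Clay; HONEST DEPENDENCY:
continuum YM on T⁴ ⇐ BetaPertH ∧ nine spine estimates (0/9 proved); BetaPertH ⇐ (D1) ∧ (D4) ∧ CAP+tail; G-an2-4 gates asym, D1 and NE2/3/4).  NEW file; imports
`B9Eq3119DeltaPiCarrier` + `B9Eq319QprimeLipschitz` + `B9Eq387CubeLocalisedProjection`; nothing modified.  Net new unproved facts: 0.
-/

noncomputable section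

open scoped InnerProductSpace BigOperators

namespace Literature.MathematicalPhysics.QuantumFieldTheory.Balaban1983to89.B9Eq387CubeSupportLetters

open B4Sect5Torus (TSite)
open B9SectCLatticeCarrier (Bond)
open B9Eq311L2Pairing (WL2)
open B11Eq103H1Complex (SiteL2K covLaplaceSiteK greenK_apply)
open B9Eq310HessianOperator (adTransportW)
open B9Eq319QprimeTorus (fineP blockCoord mem_blockOf_iff)
open B9Eq319QprimeLipschitz (norm_QprimeW_sub_flat_apply_le QprimeW_one_apply rho_nonneg)
open B9Eq326OperatorAssembly (QprimeW)
open B9Eq3119DeltaPiCarrier (laplacePrimeA GpOfU laplacePrimeA_apply_of_ker)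
open B9Eq387CubeLocalisedProjection (ker_prod_mkQ)

variable {d : ℕ} (L : ℕ) [NeZero L] (m : Fin d → ℕ)
  {W : Type*} [NormedAddCommGroup W] [InnerProductSpace ℂ W] {c₀ c₁ : ℝ}

/-! ## §1 The block-hull constraint submodule -/

omit [NeZero L] in
/-- **THE CUBE CONSTRAINT AS A SUBMODULE**: for any set `Y` of coarse sites, the gauge parameters vanishing off the block hull `ȳ⁻¹(Y)` form a
`ℂ`-submodule `N` of `L²(sites)` (membership stated pointwise; produced by `∃`, no definition). [folklore] [cite: Balaban1985BackgroundPropagators, Cor 3.6 p.408, (3.87) p.409] -/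
theorem exists_blockHull_submodule (Y : Set (TSite d m)) :
    ∃ N : Submodule ℂ (SiteL2K ℂ d (fineP L m) c₀ W),
      ∀ f : SiteL2K ℂ d (fineP L m) c₀ W, f ∈ N ↔ ∀ x : TSite d (fineP L m), blockCoord L m x ∉ Y → WL2.equiv ℂ _ W f x = 0 := by
  refine ⟨{ carrier := {f | ∀ x : TSite d (fineP L m), blockCoord L m x ∉ Y → WL2.equiv ℂ _ W f x = 0}
            add_mem' := fun {f g} hf hg x hx => by
              simp only [Set.mem_setOf_eq] at hf hg
              rw [WL2.equiv_add, Pi.add_apply, hf x hx, hg x hx, add_zero]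
            zero_mem' := fun x _ => by rw [WL2.equiv_zero, Pi.zero_apply]
            smul_mem' := fun c f hf x hx => by
              simp only [Set.mem_setOf_eq] at hf
              rw [WL2.equiv_smul, Pi.smul_apply, hf x hx, smul_zero] }, fun f => Iff.rfl⟩

/-! ## §2 `hθN`: a cutoff supported in the hull maps into `N` -/

omit [NeZero L] in
/-- **`hθN`**: a pointwise multiplier `(θλ)(x) = σ(x)·λ(x)` whose profile vanishes off the hull (`ȳ(x) ∉ Y ⇒ σ(x) = 0`) maps every `λ` into `N`.
[folklore] [cite: Balaban1985BackgroundPropagators, p.408 «h_□», (3.87) p.409] -/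
theorem mul_mem_of_vanish {Y : Set (TSite d m)} {N : Submodule ℂ (SiteL2K ℂ d (fineP L m) c₀ W)}
    (hN : ∀ f : SiteL2K ℂ d (fineP L m) c₀ W, f ∈ N ↔ ∀ x : TSite d (fineP L m), blockCoord L m x ∉ Y → WL2.equiv ℂ _ W f x = 0)
    {θ : SiteL2K ℂ d (fineP L m) c₀ W →ₗ[ℂ] SiteL2K ℂ d (fineP L m) c₀ W} {σ : TSite d (fineP L m) → ℂ}
    (hθ : ∀ (f : SiteL2K ℂ d (fineP L m) c₀ W) (x : TSite d (fineP L m)), WL2.equiv ℂ _ W (θ f) x = σ x • WL2.equiv ℂ _ W f x)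
    (hσ : ∀ x : TSite d (fineP L m), blockCoord L m x ∉ Y → σ x = 0) (f : SiteL2K ℂ d (fineP L m) c₀ W) : θ f ∈ N := by
  rw [hN]
  intro x hx
  rw [hθ, hσ x hx, zero_smul]

/-! ## §3 Block-locality of the background averaging `Q′(U)` -/

section Local

variable {𝔸 : Type*} [Ring 𝔸] [Algebra ℂ 𝔸] (φA : W ≃ₗ[ℂ] 𝔸) (U : Bond d (fineP L m) → 𝔸ˣ)

/-- **`Q′(U)` IS BLOCK-LOCAL**: in the bond window `‖R(U(b))w − w‖ ≤ ε‖w‖`, a parameter vanishing on the block `B(y)` has `(Q′(U)λ)(y) = 0` — the (ρ′)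
block form bounds `‖(Q′(U)λ)(y) − (Q′(1)λ)(y)‖` by `ρ′·L^{−d}Σ_{x∈B(y)}‖λ(x)‖ = 0` and the flat block mean vanishes. ((3.19) reads `λ` on `B(y)` only.)
[cite: Balaban1985BackgroundPropagators, (3.19) p.393, p.403] -/
theorem QprimeW_apply_eq_zero_of_vanish_on_block {ε : ℝ} (hε : 0 ≤ ε) (hR : ∀ b w, ‖adTransportW φA U b w - w‖ ≤ ε * ‖w‖)
    (lam : SiteL2K ℂ d (fineP L m) c₀ W) (y : TSite d m)
    (hlam : ∀ x : TSite d (fineP L m), blockCoord L m x = y → WL2.equiv ℂ _ W lam x = 0) :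
    QprimeW L m φA U (c₀ := c₀) lam y = 0 := by
  have hx0 : ∀ x ∈ B9Eq319QprimeTorus.blockOf L m y, (WL2.linearEquiv ℂ ℂ (fun _ : TSite d (fineP L m) => c₀) lam) x = 0 :=
    fun x hx => by rw [WL2.linearEquiv_apply]; exact hlam x ((mem_blockOf_iff L m y x).1 hx)
  have hflat : QprimeW L m φA (fun _ => 1) (c₀ := c₀) lam y = 0 := by
    rw [QprimeW_one_apply]
    exact Finset.sum_eq_zero fun x hx => by rw [hx0 x hx, smul_zero]
  have h := norm_QprimeW_sub_flat_apply_le L m φA U hε hR lam y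
  rw [hflat, sub_zero, Finset.sum_eq_zero (fun x hx => by rw [hx0 x hx, norm_zero]), mul_zero, mul_zero] at h
  exact norm_le_zero_iff.1 h

/-! ## §4 `hΨN`: a block-local section maps `Q′(U)(θλ)` into `N` -/

/-- **`hΨN`**: if `Ψ` is BLOCK-LOCAL (`g(y) = 0 ⇒ (Ψg)(x) = 0` whenever `ȳ(x) = y` — clause (ii) of `B9Eq319BumpSectionBackgroundExact.exists_bump_section_background`,
and trivially true for the transport-free `φ ⊗ g∘ȳ`), `θ` is a multiplier supported in the hull and `Q′ := (L²-reading)⁻¹ ∘ Q′(U)`, then `Ψ(Q′(θλ)) ∈ N`: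
off the hull `θλ` vanishes on the whole block `B(y)`, so `(Q′(U)(θλ))(y) = 0` (§3), so `Ψ(…)` vanishes at every `x` over `y`.
[cite: Balaban1985BackgroundPropagators, Cor 3.6 p.408, (3.87) p.409, (3.19) p.393] -/
theorem section_QprimeW_mul_mem {ε : ℝ} (hε : 0 ≤ ε) (hR : ∀ b w, ‖adTransportW φA U b w - w‖ ≤ ε * ‖w‖)
    {Y : Set (TSite d m)} {N : Submodule ℂ (SiteL2K ℂ d (fineP L m) c₀ W)}
    (hN : ∀ f : SiteL2K ℂ d (fineP L m) c₀ W, f ∈ N ↔ ∀ x : TSite d (fineP L m), blockCoord L m x ∉ Y → WL2.equiv ℂ _ W f x = 0)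
    {θ : SiteL2K ℂ d (fineP L m) c₀ W →ₗ[ℂ] SiteL2K ℂ d (fineP L m) c₀ W} {σ : TSite d (fineP L m) → ℂ}
    (hθ : ∀ (f : SiteL2K ℂ d (fineP L m) c₀ W) (x : TSite d (fineP L m)), WL2.equiv ℂ _ W (θ f) x = σ x • WL2.equiv ℂ _ W f x)
    (hσ : ∀ x : TSite d (fineP L m), blockCoord L m x ∉ Y → σ x = 0)
    {Ψ : SiteL2K ℂ d m c₁ W →ₗ[ℂ] SiteL2K ℂ d (fineP L m) c₀ W}
    (hΨloc : ∀ (g : SiteL2K ℂ d m c₁ W) (y : TSite d m), WL2.equiv ℂ _ W g y = 0 →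
      ∀ x : TSite d (fineP L m), blockCoord L m x = y → WL2.equiv ℂ _ W (Ψ g) x = 0)
    (lam : SiteL2K ℂ d (fineP L m) c₀ W) :
    Ψ ((WL2.linearEquiv ℂ ℂ (fun _ : TSite d m => c₁)).symm (QprimeW L m φA U (c₀ := c₀) (θ lam))) ∈ N := by
  rw [hN]
  intro x hx
  refine hΨloc _ (blockCoord L m x) ?_ x rfl
  rw [WL2.linearEquiv_symm_apply, Equiv.apply_symm_apply]
  refine QprimeW_apply_eq_zero_of_vanish_on_block L m φA U hε hR (θ lam) (blockCoord L m x) fun x' hx' => ?_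
  rw [hθ, hσ x' (by rw [hx']; exact hx), zero_smul]

end Local

/-! ## §5 `hker`: the cube constraint -/

section Ker

variable {𝕜 : Type*} [RCLike 𝕜] {S : Type*} [NormedAddCommGroup S] [InnerProductSpace 𝕜 S] {F' : Type*} [AddCommGroup F'] [Module 𝕜 F']

/-- **`hker`** in the consumer's shape: `ker Q′ ⊓ N ≤ ker(Q′ × N.mkQ)` — S-P6′ §2's `ker_prod_mkQ` (equality) read as the inclusion the (β) bound asks for.
[folklore] [cite: Balaban1985BackgroundPropagators, Cor 3.6 p.408, (3.87) p.409] -/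
theorem ker_inf_le_ker_prod_mkQ (Q' : S →ₗ[𝕜] F') (N : Submodule 𝕜 S) : LinearMap.ker Q' ⊓ N ≤ LinearMap.ker (Q'.prod N.mkQ) :=
  (ker_prod_mkQ Q' N).ge

end Ker

/-! ## §6 `hH`, `hGH`: the chain's Green data at the letters -/

section Green

variable {𝔸 : Type*} [Ring 𝔸] [Algebra ℂ 𝔸] (φA : W ≃ₗ[ℂ] 𝔸) [Fact (0 < c₀)] [Fact (0 < c₁)] [FiniteDimensional ℂ W]
  (η : ℝ) (U : Bond d (fineP L m) → 𝔸ˣ) (a' : ℝ)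

/-- **`hH`**: on the kernel of the consumer's `Q′ := (L²-reading)⁻¹ ∘ Q′(U)`, the chain's `Δ′_{a′}(U)` IS `Δ^η_U = D*_UD_U` ((3.24): the `Q′*a′Q′` term drops).
[cite: Balaban1985BackgroundPropagators, (3.24) p.394, (3.23) p.394] -/
theorem laplacePrimeA_eq_of_ker (u : SiteL2K ℂ d (fineP L m) c₀ W)
    (hu : ((WL2.linearEquiv ℂ ℂ (fun _ : TSite d m => c₁)).symm.toLinearMap ∘ₗ QprimeW L m φA U (c₀ := c₀)) u = 0) :
    laplacePrimeA L m φA η U a' (c₁ := c₁) u = covLaplaceSiteK ((η : ℂ))⁻¹ (adTransportW φA U) (adTransportW φA fun b => (U b)⁻¹) u := by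
  have hu' : QprimeW L m φA U (c₀ := c₀) u = 0 := by
    rw [LinearMap.comp_apply, LinearEquiv.coe_toLinearMap, LinearEquiv.map_eq_zero_iff] at hu
    exact hu
  exact laplacePrimeA_apply_of_ker L m φA η U a' hu'

/-- **`hGH`**: `G′(U)(Δ′_{a′}(U)s) = s` — the chain's `GpOfU` is `greenK` of `laplacePrimeA`. [cite: Balaban1985BackgroundPropagators, (3.25) p.394, Thm 3.11 p.416] -/
theorem GpOfU_laplacePrimeA
    (hpos' : ∀ x : SiteL2K ℂ d (fineP L m) c₀ W, x ≠ 0 → 0 < RCLike.re ⟪x, laplacePrimeA L m φA η U a' (c₁ := c₁) x⟫_ℂ)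
    (s : SiteL2K ℂ d (fineP L m) c₀ W) :
    GpOfU L m φA η U a' (c₁ := c₁) hpos' (laplacePrimeA L m φA η U a' (c₁ := c₁) s) = s :=
  greenK_apply hpos' s

end Green

end Literature.MathematicalPhysics.QuantumFieldTheory.Balaban1983to89.B9Eq387CubeSupportLetters

end
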